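import Literature.AnabelianGeometry.EtaleTheta.Discharge.Sec3CnstOfConstField
import Literature.AnabelianGeometry.EtaleTheta.Discharge.Sec3Prop34CnstOfRlfQWeak
import Literature.AnabelianGeometry.EtaleTheta.Discharge.Sec3Prop34CnstOfRlfRWeak
import Literature.AnabelianGeometry.EtaleTheta.TemperedFrobenioidCnstTorsion
import Literature.AnabelianGeometry.EtaleTheta.TemperedFrobenioidOfGaloisCoveringTateTowerArith
import Literature.AnabelianGeometry.EtaleTheta.LogDivisorModelTateTowerArithmeticGaussian
import HarnessLib

/-!
# [EtTh] Theorem 3.7 (iii) — NODE CLOSER: print's two sentences as ONE theorem in print's shape (real predicates,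
# any vocabulary, any monoid type), AS TYPED (`TemperedFrobenioid.Thm37_iii`) at facade reading slots, and
# BINDER-FREE at the connected constructed data keyed on a constant field (the counting path of record)

S. Mochizuki, *The étale theta function and its Frobenioid-theoretic manifestations*, Publ. RIMS **45**
(2009) [EtTh], §3, Theorem 3.7 (iii): statement PDF p. 79 l. 37 – p. 80 l. 6 (printed pp. 305–306), proof PDF
p. 80 l. 22 of `paper:doi-10-2977-prims-1234361159` [cite: MochizukiEtTh2009, Thm 3.7 (iii) p.79]:

> "(iii) Let `A ∈ Ob(C)`; `A_D := Base(A) ∈ Ob(D)`. Write `A^cnst ∈ Ob(D^cnst)` for the image of `A_D` in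
> `D^cnst` [cf. the discussion preceding Definition 3.3]. Then the natural action of `Aut_C(A)` on `O^▷(A)` and
> `O^×(A)` factors through `Aut_{D^cnst}(A^cnst)`. If, moreover, `Λ ∈ {ℤ, ℚ}`, then this factorization
> determines a faithful action of the image of `Aut_C(A)` in `Aut_{D^cnst}(A^cnst)` on `O^▷(A)`, `O^×(A)`."
> Proof (p. 80): "Assertion (iii) follows immediately from Proposition 3.4, (ii)."

Proof-only companion (theorems only: no `def`, no `Prop` fact, no instance; abc-iut cell, layer L2, cone node
**`EtTh:Thm3.7(iii)`**; R-C «per-node clause coverage», seat abc-iut-w6-d039; sibling of `Sec3Thm37iNode` /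
`Sec3Thm37iiNode` (abc-iut-w4-d103, p455829 / p455367) and `Sec3Thm37ivNode` (p456601)).  Nothing landed is edited
or restated; every clause-level closer already exists and is consumed BY NAME:

* the two printed sentences as REAL predicates over a constant-field functor `K` on the base category —
  `FrobenioidFacade.AutActionFactorsThrough K` / `AutActionFaithful K` (abc-iut-L2-t3, `TemperedFrobenioidCnst`,
  p416716), here `K := (D → D₀) ⋙ cnst` with `cnst : D₀ ⥤ D^cnst` the DATUM "the natural functor `D₀ → D^cnst`"
  of p. 72 (`D^cnst = B(Spec K)⁰`);
* their proofs from print's own input "Proposition 3.4, (ii)" relative to `D^cnst` — the hypothesis structure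
  `RealifiedDivisorMonoids.Prop34Cnst T cnst` (NATURALITY of `O_L^× ⥲ Ker(B₀ → Φ₀^gp)`, `L^× ⥲ F₀(Y)` in `Y`, and
  "`Aut(L/K)` acts faithfully on `O_L^×`") — `autActionFactorsThrough_of_prop34Cnst` /
  `autActionFaithful_of_prop34Cnst` (abc-iut-L2-t3, `Sec3Thm37Cnst`, p417345; Frobenioid-side halves
  `ModelFrobenioid.autAction_factorsThroughBase` p414019 / `Sec3Thm37AutAction` p414569, sub-DAG rows L08–L11);
* `Prop34Cnst` at every CONSTRUCTED Def. 3.6 (i) datum from Def. 3.3 (iii)-level inputs: `Prop34Cnst.ofRlfZ` /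
  `ofRlfZWeak` (p418261, abc-iut-L2-d2), `ofRlfQ_of_torsion₀` (abc-iut-w4-d084 / L2-t3 p440182), `ofRlfR_of_eff`
  (abc-iut-w5-d130 p424819); and — the COUNTING PATH OF RECORD (abc-iut-L2-lead R507: «Thm 3.7 (iii) at the connected
  constructed data keyed on DATA ConstField — w6-d058») — `DivisorMonoids.prop34Cnst₀_of_constField` (abc-iut-w6-d058,
  `Sec3CnstOfConstField` p454787 over `Sec3Prop34CnstOfGaloisCovering` p448151): at the Def. 3.3 (iii) data of the
  CONNECTED coverings dominated by one universal combinatorial covering `Z^log_∞` with print's NON-CONSTANT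
  constant-field functor `Y ↦ N∖Y` (`GaloisAction.cnstFunctor`), ALL clauses of Prop. 3.4 (ii) are THEOREMS once a
  constant field `GaloisAction.ConstField` of `Z^log_∞` is GIVEN AS DATA.

THIS FILE assembles them into the node's own shape so that the residual is read off ONE signature:

* §1 `thm37_iii_node (cnst) (P : T.Prop34Cnst cnst)` — ANY vocabulary `VD`, ANY monoid type `Λ`, print's
  "if, moreover, `Λ ∈ {ℤ, ℚ}`" as an antecedent INSIDE: sentence 1 ∧ (`Λ ∈ {ℤ, ℚ}` → sentence 2) for EVERY object
  `A`.  Residual = {`cnst` (DATA, p. 72), `P` (print's own input Prop. 3.4 (ii) relative to `D^cnst` = cone node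
  `EtTh:Prop3.4(ii)` BY NAME)} — NO `hBmon` / `IsFrobenioid` / divisoriality / (i)(ii)(iv) binder: (iii) holds for the
  model category of ANY Def. 3.6 data.  `thm37_iii_node_ofRlfZ` / `_ofRlfZWeak` / `_ofRlfQ` / `_ofRlfR`: `P` ⟸ the
  Def. 3.3 (iii)-level bundles {`dm.Prop34`, `dm.Prop34Cnst₀ cnst`} (+ `Prop34Cnst₀Torsion` at `Λ = ℚ`, + the
  effective-locus clause `hE` at `Λ = ℝ`) at the constructed data of each monoid type.
* §2 AS TYPED.  abc-iut-L2-t3's typed node statement `TemperedFrobenioid.Thm37_iii C₀ F` reads both sentences through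
  two FREE fields of the hypothesis vocabulary `F : FrobenioidFacade D`; its universal closure is refuted in the tree
  (FACT row F-1312 = a schema: `TemperedFrobenioid.not_forall_thm37_iii`, `TemperedFrobenioidPropsSchemaNegative`).
  `thm37_iii_of_slot` inhabits `C₀.Thm37_iii F` at EVERY facade whose two Thm. 3.7 (iii) fields are implied AT `C₀` by
  the real predicates over `(D → D₀) ⋙ cnst` (reading slots `hFac`, `hFaith`), from `P` alone; the canonical slot
  `F.withCnst ((D → D₀) ⋙ cnst)` (`hFac = hFaith = id`) is abc-iut-L2-t3's `thm37_iii_withCnst` (p417345, not restated).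
* §3 BINDER-FREE AT THE CONNECTED CONSTRUCTED DATA KEYED ON A CONSTANT FIELD: `thm37_iii_node_of_constField
  (C : A.ConstField K L Γ₀)` — the node in print's shape for EVERY tempered Frobenioid (any base category, any
  vocabulary) over the type-`ℤ` Def. 3.6 (i) data `ofRlfZWeak (ofGaloisActionConnected A hZ) hpf`, with print's
  `D₀ → D^cnst`, NO `Prop` binder (the Galois-correspondence law `hGC` of GAP G-w6d058-2 is `C.constGaloisLaw`); the
  second sentence WITHOUT its antecedent there (`Λ = ℤ` definitionally): `thm37_iii_faithful_of_constField`; the typed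
  node at every reading slot there: `thm37_iii_of_slot_of_constField`; with the law as a binder instead of the data:
  `thm37_iii_node_ofGaloisActionConnected (hGC)`.
* §4 AT THE ARITHMETIC TATE TOWER (class (b) model of record with a GENUINE, non-trivial constant field, abc-iut-w6-d058
  `LogDivisorModelTateTowerArithmetic` / `TemperedFrobenioidOfGaloisCoveringTateTowerArith`): for every parameter record
  `D : TateTowerArith.Datum K L` the node holds for every tempered Frobenioid over the tower's connected data
  (`thm37_iii_node_tateTowerArith`, data `D.action`, `D.cuspLaws`, `D.constField` — nothing assumed) and in particular
  for THE constructed tempered Frobenioid `TateTowerArithFrd.temperedFrobenioid D` (`thm37_iii_node_tateTowerArithFrd`;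
  AS TYPED `thm37_iii_tateTowerArithFrd`); NON-VACUITY at `Datum.gaussian` (`ℚ(i)/ℚ` at the inert prime `3`, abc-iut-w5-d223
  p470141: `Aut(ℚ(i)/ℚ) = {1, conj} ≠ 1`, `conj ∉ N` — the constant-field functor is NOT constant there):
  `thm37_iii_node_gaussianFrd`.

Out of scope (separate rows, not this node): the ζ-twisted Kummer tower (abc-iut-L2-d2, third model of record) where
the CONSTANT-`D^cnst` shortcut is refuted (`TateTowerKummerTwist.not_prop34Cnst₀_const`, p483973) and print's
non-constant `D^cnst` is row «PROP34CNST₀ WITH NON-CONSTANT D^cnst AT THE TWISTED TOWER» (abc-iut-L2-lead R914).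
HONEST FRAMING: refereed pre-IUT material ([EtTh] §3 over [FrdI] Thm. 5.2 (i)); bookkeeping over PROVED rows, no new
mathematics; the one residual binder of §1 is print's own input (Prop. 3.4 (ii)), a THEOREM at the data of §§3–4;
nothing here bears on [IUTchIII] Cor. 3.12; no statement of the paper is strengthened; typed ≠ proved — here PROVED
modulo the literal binders, and binder-free where stated.
-/

namespace Literature.AnabelianGeometry.EtaleTheta

open CategoryTheory Opposite Literature.AlgebraicGeometry.Frobenioids

namespace TemperedFrobenioid

universe u₀ v₀ u₁ v₁ u v w

/-! ### §1 The node in print's shape: real predicates, any vocabulary, any monoid type -/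

section AnyVocab

variable {D₀ : Type u₀} [Category.{v₀} D₀] {V : FrdIMonoidStub.{w}}
  {T : RealifiedDivisorMonoids (D₀ := D₀) V} {D : Type u} [Category.{v} D]
  {VD : FrdICatStub.{u, v, w} D} (C₀ : TemperedFrobenioid T D VD)
  {Dcnst : Type u₁} [Category.{v₁} Dcnst]

/-- **[EtTh] Thm 3.7 (iii) — the node in print's shape** (any vocabulary, any monoid type `Λ`): for the tempered
Frobenioid `C` (the model Frobenioid of the Def. 3.6 data) and the constant-field functor `cnst : D₀ → D^cnst`
(p. 72), GIVEN print's input Prop. 3.4 (ii) relative to `D^cnst` (`P`): for every `A ∈ Ob(C)` (sentence 1) the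
natural action of `Aut_C(A)` on `O^▷(A)` and `O^×(A)` factors through `Aut_{D^cnst}(A^cnst)` — automorphisms with
the same image under `Aut_C(A) → Aut_D(A_D) → Aut_{D^cnst}(A^cnst)` conjugate `O^▷(A)`, `O^×(A)` identically — AND
(sentence 2) if `Λ ∈ {ℤ, ℚ}` the induced action of the image is faithful — automorphisms conjugating `O^×(A)`
identically have the same image.  Composition of `autActionFactorsThrough_of_prop34Cnst` and
`autActionFaithful_of_prop34Cnst` (p417345); residual = {`P`} = cone node `EtTh:Prop3.4(ii)` (rel. `D^cnst`) BY NAME.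
[cite: MochizukiEtTh2009, Thm 3.7 (iii) p.79] -/
theorem thm37_iii_node (cnst : D₀ ⥤ Dcnst) (P : T.Prop34Cnst cnst) :
    (∀ A : C₀.category, FrobenioidFacade.AutActionFactorsThrough (C₀.base ⋙ cnst) C₀.toElem A) ∧
      (C₀.monoidType = MonoidType.Z ∨ C₀.monoidType = MonoidType.Q →
        ∀ A : C₀.category, FrobenioidFacade.AutActionFaithful (C₀.base ⋙ cnst) C₀.toElem A) :=
  ⟨fun A => C₀.autActionFactorsThrough_of_prop34Cnst P A, fun hΛ A => C₀.autActionFaithful_of_prop34Cnst P hΛ A⟩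

/-- **The node UNFOLDED at one object** — print's words for `A`, `α, β ∈ Aut_C(A)` (conjugation `f ↦ α⁻¹ ∘ f ∘ α`):
same image in `Aut_{D^cnst}(A^cnst)` ⇒ same conjugation on `O^▷(A)` (`PreFrobenioid.endSubmonoid`) and on `O^×(A)`
(`PreFrobenioid.unitsSubgroup`); and, for `Λ ∈ {ℤ, ℚ}`, same conjugation on `O^×(A)` ⇒ same image in
`Aut_{D^cnst}(A^cnst)`. [cite: MochizukiEtTh2009, Thm 3.7 (iii) p.79] -/
theorem thm37_iii_node_apply (cnst : D₀ ⥤ Dcnst) (P : T.Prop34Cnst cnst) (A : C₀.category) (α β : A ≅ A) :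
    (cnst.map (C₀.base.map (ModelFrobenioid.baseMap α.hom)) = cnst.map (C₀.base.map (ModelFrobenioid.baseMap β.hom)) →
      (∀ f ∈ PreFrobenioid.endSubmonoid C₀.toElem A, α.inv ≫ f ≫ α.hom = β.inv ≫ f ≫ β.hom) ∧
        ∀ u ∈ PreFrobenioid.unitsSubgroup C₀.toElem A, α.symm ≪≫ u ≪≫ α = β.symm ≪≫ u ≪≫ β) ∧
    (C₀.monoidType = MonoidType.Z ∨ C₀.monoidType = MonoidType.Q →
      (∀ u ∈ PreFrobenioid.unitsSubgroup C₀.toElem A, α.symm ≪≫ u ≪≫ α = β.symm ≪≫ u ≪≫ β) →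
        cnst.map (C₀.base.map (ModelFrobenioid.baseMap α.hom)) =
          cnst.map (C₀.base.map (ModelFrobenioid.baseMap β.hom))) :=
  ⟨fun h => (C₀.thm37_iii_node cnst P).1 A α β h, fun hΛ h => (C₀.thm37_iii_node cnst P).2 hΛ A α β h⟩

end AnyVocab

/-! ### §1′ The binder `P` from Def. 3.3 (iii)-level inputs at the CONSTRUCTED Def. 3.6 (i) data of each monoid type -/

section OfRlfZ

variable {D₀ : Type u} [Category.{v} D₀] {dm : DivisorMonoids.{u, v, w} D₀}
  {hpf : ∀ Y : D₀ᵒᵖ, IsPerfFactorial (dm.Φ₀.obj Y)} {V : FrdIMonoidStub.{w}} {V₀ : FrdICatStub.{u, v, w} D₀}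
  {D : Type u₀} [Category.{v₀} D] {VD : FrdICatStub.{u₀, v₀, w} D}
  (C₀ : TemperedFrobenioid (RealifiedDivisorMonoids.ofRlfZ dm hpf) D VD)
  {Dcnst : Type u₁} [Category.{v₁} Dcnst]

/-- **The node at the constructed data of monoid type `ℤ`** (`ofRlfZ dm hpf`; the antecedent `Λ ∈ {ℤ, ℚ}` HOLDS, so
sentence 2 is asserted outright): residual = {`h34 : dm.Prop34` (Prop. 3.4 (ii) `B₀`-level bundle), `h₀ : dm.Prop34Cnst₀
cnst` (its `D^cnst`-naturality clauses)} — statements about the Def. 3.3 (iii) data only (`Prop34Cnst.ofRlfZ`, p418261).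
[cite: MochizukiEtTh2009, Thm 3.7 (iii) p.79] -/
theorem thm37_iii_node_ofRlfZ (cnst : D₀ ⥤ Dcnst) (h34 : dm.Prop34 V V₀) (h₀ : dm.Prop34Cnst₀ cnst) :
    (∀ A : C₀.category, FrobenioidFacade.AutActionFactorsThrough (C₀.base ⋙ cnst) C₀.toElem A) ∧
      ∀ A : C₀.category, FrobenioidFacade.AutActionFaithful (C₀.base ⋙ cnst) C₀.toElem A :=
  have h := C₀.thm37_iii_node cnst (RealifiedDivisorMonoids.Prop34Cnst.ofRlfZ h34 h₀)
  ⟨h.1, h.2 (Or.inl rfl)⟩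

end OfRlfZ

section OfRlfZWeak

variable {D₀ : Type u} [Category.{v} D₀] {dm : DivisorMonoids.{u, v, w} D₀}
  {hpf : ∀ Y : D₀ᵒᵖ, IsPerfFactorialCof (dm.Φ₀.obj Y)} {V : FrdIMonoidStub.{w}} {V₀ : FrdICatStub.{u, v, w} D₀}
  {D : Type u₀} [Category.{v₀} D] {VD : FrdICatStub.{u₀, v₀, w} D}
  (C₀ : TemperedFrobenioid (RealifiedDivisorMonoids.ofRlfZWeak dm hpf) D VD)
  {Dcnst : Type u₁} [Category.{v₁} Dcnst]

/-- **The node at the weak-vocabulary constructed data of monoid type `ℤ`** (`ofRlfZWeak dm hpf`, the data of the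
models of record): residual = {`h34`, `h₀`} (`Prop34Cnst.ofRlfZWeak`, abc-iut-L2-d2).
[cite: MochizukiEtTh2009, Thm 3.7 (iii) p.79] -/
theorem thm37_iii_node_ofRlfZWeak (cnst : D₀ ⥤ Dcnst) (h34 : dm.Prop34 V V₀) (h₀ : dm.Prop34Cnst₀ cnst) :
    (∀ A : C₀.category, FrobenioidFacade.AutActionFactorsThrough (C₀.base ⋙ cnst) C₀.toElem A) ∧
      ∀ A : C₀.category, FrobenioidFacade.AutActionFaithful (C₀.base ⋙ cnst) C₀.toElem A :=
  have h := C₀.thm37_iii_node cnst (RealifiedDivisorMonoids.Prop34Cnst.ofRlfZWeak h34 h₀)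
  ⟨h.1, h.2 (Or.inl rfl)⟩

end OfRlfZWeak

section OfRlfQ

variable {D₀ : Type u} [Category.{v} D₀] {dm : DivisorMonoids.{u, v, w} D₀}
  {hpf : ∀ Y : D₀ᵒᵖ, IsPerfFactorial (dm.Φ₀.obj Y)} {V : FrdIMonoidStub.{w}} {V₀ : FrdICatStub.{u, v, w} D₀}
  {D : Type u₀} [Category.{v₀} D] {VD : FrdICatStub.{u₀, v₀, w} D}
  (C₀ : TemperedFrobenioid (RealifiedDivisorMonoids.ofRlfQ dm hpf) D VD)
  {Dcnst : Type u₁} [Category.{v₁} Dcnst]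

/-- **The node at the constructed data of monoid type `ℚ`** (`ofRlfQ dm hpf`; `Λ = ℚ ∈ {ℤ, ℚ}`, sentence 2 outright):
residual = {`h34`, `h₀`, `hT : dm.Prop34Cnst₀Torsion cnst` ("`Aut(L/K)` acts faithfully on the PERFECTION `(O_L^×)^pf`",
the `Λ = ℚ` reading of print's faithfulness step; predicate of abc-iut-L2-t3, `TemperedFrobenioidCnstTorsion`)}
(`Prop34Cnst.ofRlfQ_of_torsion₀`). [cite: MochizukiEtTh2009, Thm 3.7 (iii) p.80] -/
theorem thm37_iii_node_ofRlfQ (cnst : D₀ ⥤ Dcnst) (h34 : dm.Prop34 V V₀) (h₀ : dm.Prop34Cnst₀ cnst)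
    (hT : dm.Prop34Cnst₀Torsion cnst) :
    (∀ A : C₀.category, FrobenioidFacade.AutActionFactorsThrough (C₀.base ⋙ cnst) C₀.toElem A) ∧
      ∀ A : C₀.category, FrobenioidFacade.AutActionFaithful (C₀.base ⋙ cnst) C₀.toElem A :=
  have h := C₀.thm37_iii_node cnst (RealifiedDivisorMonoids.Prop34Cnst.ofRlfQ_of_torsion₀ h34 h₀ hT)
  ⟨h.1, h.2 (Or.inr rfl)⟩

end OfRlfQ

section OfRlfR

variable {D₀ : Type u} [Category.{v} D₀] {dm : DivisorMonoids.{u, v, w} D₀}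
  {hpf : ∀ Y : D₀ᵒᵖ, IsPerfFactorial (dm.Φ₀.obj Y)}
  {D : Type u₀} [Category.{v₀} D] {VD : FrdICatStub.{u₀, v₀, w} D}
  (C₀ : TemperedFrobenioid (RealifiedDivisorMonoids.ofRlfR dm hpf) D VD)
  {Dcnst : Type u₁} [Category.{v₁} Dcnst]

/-- **The node at the constructed data of monoid type `ℝ`** (`ofRlfR dm hpf`): print's antecedent `Λ ∈ {ℤ, ℚ}` FAILS
(`Λ = ℝ`), so only sentence 1 has content; residual = {`h₀ : dm.Prop34Cnst₀ cnst`, `hE` (the `Λ = ℝ` effective-locus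
clause of Prop. 3.4 (ii): an element of `ℝ·Φ₀^birat` that is a log-divisor lies in `ℝ·Φ₀^cnst` — abc-iut-w5-d130's
binder, a theorem at the chain / finite-support models, `Sec3Prop34CnstOfRlfRChainModel` / `…Finite` / `…Support`)}
(`Prop34Cnst.ofRlfR_of_eff`, p424819). [cite: MochizukiEtTh2009, Thm 3.7 (iii) p.79] -/
theorem thm37_iii_node_ofRlfR (cnst : D₀ ⥤ Dcnst) (h₀ : dm.Prop34Cnst₀ cnst)
    (hE : ∀ (Y : D₀) (b : Algebra.GrothendieckGroup ((RealifiedDivisorMonoids.realData dm hpf).rlf.obj (op Y)))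
      (x : (hpf (op Y)).Rlf),
      b ∈ ((RealifiedDivisorMonoids.realData dm hpf).realSpan dm.biratGp).carrier Y →
        b = Algebra.GrothendieckGroup.of x →
          b ∈ ((RealifiedDivisorMonoids.realData dm hpf).realSpan dm.cnstGp).carrier Y) :
    ∀ A : C₀.category, FrobenioidFacade.AutActionFactorsThrough (C₀.base ⋙ cnst) C₀.toElem A :=
  (C₀.thm37_iii_node cnst (RealifiedDivisorMonoids.Prop34Cnst.ofRlfR_of_eff h₀ hE)).1

end OfRlfR

/-! ### §2 AS TYPED: `TemperedFrobenioid.Thm37_iii C₀ F` at facade reading slots -/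

section AsTyped

variable {D₀ : Type u₀} [Category.{v₀} D₀] {V : FrdIMonoidStub.{w}}
  {T : RealifiedDivisorMonoids (D₀ := D₀) V} {D : Type u} [Category.{v} D]
  {VD : FrdICatStub.{u, v, w} D} (C₀ : TemperedFrobenioid T D VD)
  {Dcnst : Type u₁} [Category.{v₁} Dcnst]

/-- **[EtTh] Thm 3.7 (iii) AS TYPED** (abc-iut-L2-t3's `Thm37_iii`, p407532) **at facade reading slots**: for every
hypothesis vocabulary `F : FrobenioidFacade D` whose field "the action of `Aut_C(A)` on `O^▷(A)`, `O^×(A)` factors through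
`Aut_{D^cnst}(A^cnst)`" is implied AT `C₀` by the real predicate `AutActionFactorsThrough ((D → D₀) ⋙ cnst)` (slot `hFac`)
and whose field "faithfully" is implied AT `C₀` by `AutActionFaithful ((D → D₀) ⋙ cnst)` (slot `hFaith`) — i.e. every
facade READING `D^cnst`, `A^cnst` through print's functor `D₀ → D^cnst` — the typed statement `C₀.Thm37_iii F` HOLDS,
from `P` alone.  The free-slot schema itself is refuted as a universal closure (F-1312, `not_forall_thm37_iii`); this is
its inhabitant at every honest slot; the canonical slot `F.withCnst ((D → D₀) ⋙ cnst)` is `thm37_iii_withCnst` (p417345).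
[cite: MochizukiEtTh2009, Thm 3.7 (iii) p.79] -/
theorem thm37_iii_of_slot (F : FrobenioidFacade.{u, v, w} D) (cnst : D₀ ⥤ Dcnst) (P : T.Prop34Cnst cnst)
    (hFac : ∀ A : C₀.category, FrobenioidFacade.AutActionFactorsThrough (C₀.base ⋙ cnst) C₀.toElem A →
      F.AutActionFactorsThroughCnst C₀.toElem A)
    (hFaith : ∀ A : C₀.category, FrobenioidFacade.AutActionFaithful (C₀.base ⋙ cnst) C₀.toElem A →
      F.AutActionFaithfulCnst C₀.toElem A) :
    C₀.Thm37_iii F :=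
  ⟨fun A => hFac A ((C₀.thm37_iii_node cnst P).1 A),
    fun hΛ A => hFaith A ((C₀.thm37_iii_node cnst P).2 hΛ A)⟩

end AsTyped

/-! ### §3 BINDER-FREE at the connected constructed data keyed on a constant field (counting path of record) -/

section GaloisCovering

open LogDivisorModel.GaloisAction

variable {Z : LogDivisorModel.{u}} {G : Type u} [Group G] (A : Z.GaloisAction G) (hZ : Z.CuspLaws)
  {hpf : ∀ Y : ((isConnectedGSet (G := G)).FullSubcategory)ᵒᵖ,
    IsPerfFactorialCof ((DivisorMonoids.ofGaloisActionConnected A hZ).Φ₀.obj Y)}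
  {D : Type u₀} [Category.{v₀} D] {VD : FrdICatStub.{u₀, v₀, u} D}
  (C₀ : TemperedFrobenioid
    (RealifiedDivisorMonoids.ofRlfZWeak (DivisorMonoids.ofGaloisActionConnected A hZ) hpf) D VD)
  {K L : Type u₁} [Field K] [Field L] [Algebra K L] {Γ₀ : Type v₁} [LinearOrderedCommGroupWithZero Γ₀]

/-- **The node at the connected constructed data with print's `D₀ → D^cnst`, from the Galois-correspondence law**:
over the type-`ℤ` Def. 3.6 (i) data of the CONNECTED coverings dominated by `Z^log_∞` (`ofGaloisActionConnected A hZ`;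
abc-iut-w5-d179 / w6-d058) with the constant-field functor `Y ↦ N∖Y` (`cnstFunctor`, `N = Ker(G → Aut(L'^×))`), both
Def. 3.3 (iii)-level bundles are THEOREMS (`prop34_ofGaloisActionConnected`, `prop34Cnst₀_ofGaloisActionConnected`,
p448151): residual = {`hGC : A.ConstGaloisLaw`} (GAP G-w6d058-2: "an element fixing all `H`-invariant unit constants lies
in `N·H`" — Galois theory of the constant field) only; BOTH sentences outright (`Λ = ℤ`).
[cite: MochizukiEtTh2009, Thm 3.7 (iii) p.79] -/
theorem thm37_iii_node_ofGaloisActionConnected (hGC : A.ConstGaloisLaw) :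
    (∀ X : C₀.category, FrobenioidFacade.AutActionFactorsThrough (C₀.base ⋙ A.cnstFunctor) C₀.toElem X) ∧
      ∀ X : C₀.category, FrobenioidFacade.AutActionFaithful (C₀.base ⋙ A.cnstFunctor) C₀.toElem X :=
  C₀.thm37_iii_node_ofRlfZWeak A.cnstFunctor
    (DivisorMonoids.prop34_ofGaloisActionConnected A hZ (fun _ => True) fun _ => True)
    (DivisorMonoids.prop34Cnst₀_ofGaloisActionConnected A hZ hGC)

/-- **[EtTh] Thm 3.7 (iii) — the node BINDER-FREE at the connected constructed data keyed on a CONSTANT FIELD**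
(abc-iut-L2-lead R507's counting path of record: «Thm 3.7 (iii) at the connected constructed data keyed on DATA
ConstField — w6-d058»): given a constant field `C : ConstField A K L Γ₀` of `Z^log_∞` (DATA: `L^× ↪ Fn`, the restriction
`G → Aut(L/K)`, a Galois-invariant valuation cutting out `O_L^▷`; `LogDivisorModelConstantFieldGalois`), the
Galois-correspondence law is the THEOREM `C.constGaloisLaw`, so for EVERY tempered Frobenioid `C₀` — any base category
`D`, any base functor `D → D₀`, any category vocabulary — over the type-`ℤ` Def. 3.6 (i) data of the connected coverings,
with print's NON-constant `D₀ → D^cnst`: (sentence 1) for every `A`, automorphisms of `A` with the same image in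
`Aut_{D^cnst}(A^cnst)` conjugate `O^▷(A)` and `O^×(A)` identically, AND (sentence 2, `Λ = ℤ`) automorphisms conjugating
`O^×(A)` identically have the same image in `Aut_{D^cnst}(A^cnst)`.  NO `Prop` binder.
[cite: MochizukiEtTh2009, Thm 3.7 (iii) p.79] -/
theorem thm37_iii_node_of_constField (C : A.ConstField K L Γ₀) :
    (∀ X : C₀.category, FrobenioidFacade.AutActionFactorsThrough (C₀.base ⋙ A.cnstFunctor) C₀.toElem X) ∧
      ∀ X : C₀.category, FrobenioidFacade.AutActionFaithful (C₀.base ⋙ A.cnstFunctor) C₀.toElem X :=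
  C₀.thm37_iii_node_ofGaloisActionConnected A hZ C.constGaloisLaw

/-- **Sentence 2 ALONE, binder-free, antecedent-free** at the same data: "this factorization determines a faithful
action of the image of `Aut_C(A)` in `Aut_{D^cnst}(A^cnst)` on `O^▷(A)`, `O^×(A)`" — print's words for `α, β ∈ Aut_C(A)`.
[cite: MochizukiEtTh2009, Thm 3.7 (iii) p.80] -/
theorem thm37_iii_faithful_of_constField (C : A.ConstField K L Γ₀) (X : C₀.category) (α β : X ≅ X)
    (h : ∀ u ∈ PreFrobenioid.unitsSubgroup C₀.toElem X, α.symm ≪≫ u ≪≫ α = β.symm ≪≫ u ≪≫ β) :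
    A.cnstFunctor.map (C₀.base.map (ModelFrobenioid.baseMap α.hom)) =
      A.cnstFunctor.map (C₀.base.map (ModelFrobenioid.baseMap β.hom)) :=
  (C₀.thm37_iii_node_of_constField A hZ C).2 X α β h

/-- **The typed node `C₀.Thm37_iii F` at EVERY reading slot over that data, binder-free** (slots `hFac`, `hFaith` read
the facade's two Thm. 3.7 (iii) fields through print's `D₀ → D^cnst`; the canonical slot `F.withCnst (base ⋙ cnstFunctor)`
is abc-iut-w6-d058's `DivisorMonoids.thm37_iii_rlfZ_of_constField`, p454787, not restated).
[cite: MochizukiEtTh2009, Thm 3.7 (iii) p.79] -/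
theorem thm37_iii_of_slot_of_constField (C : A.ConstField K L Γ₀) (F : FrobenioidFacade.{u₀, v₀, u} D)
    (hFac : ∀ X : C₀.category, FrobenioidFacade.AutActionFactorsThrough (C₀.base ⋙ A.cnstFunctor) C₀.toElem X →
      F.AutActionFactorsThroughCnst C₀.toElem X)
    (hFaith : ∀ X : C₀.category, FrobenioidFacade.AutActionFaithful (C₀.base ⋙ A.cnstFunctor) C₀.toElem X →
      F.AutActionFaithfulCnst C₀.toElem X) :
    C₀.Thm37_iii F :=
  ⟨fun X => hFac X ((C₀.thm37_iii_node_of_constField A hZ C).1 X),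
    fun _ X => hFaith X ((C₀.thm37_iii_node_of_constField A hZ C).2 X)⟩

end GaloisCovering

/-! ### §4 At the ARITHMETIC Tate tower: genuine non-trivial constant field, nothing assumed -/

section TateTowerArith

open LogDivisorModel LogDivisorModel.GaloisAction

variable {K L : Type} [Field K] [Field L] [Algebra K L] (Dt : TateTowerArith.Datum K L)

/-- **The node at the arithmetic Tate tower of a parameter record `Dt : TateTowerArith.Datum K L`** (a finite extension
`L/K` with an `Aut(L/K)`-invariant discrete valuation and a `K`-rational Tate parameter; Galois group `ℤ × Aut(L/K)`;
abc-iut-w6-d058 `LogDivisorModelTateTowerArithmetic`): the log-divisor model `Dt.model`, its Galois action `Dt.action`,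
the cusp laws `Dt.cuspLaws` and the constant field `Dt.constField` are all CONSTRUCTED, so the node holds — both sentences,
print's non-constant `D₀ → D^cnst` — for EVERY tempered Frobenioid over the tower's connected type-`ℤ` data, with NOTHING
assumed. [cite: MochizukiEtTh2009, Thm 3.7 (iii) p.79] -/
theorem thm37_iii_node_tateTowerArith
    {hpf : ∀ Y : ((isConnectedGSet (G := TateTowerArith.Grp K L)).FullSubcategory)ᵒᵖ,
      IsPerfFactorialCof ((DivisorMonoids.ofGaloisActionConnected Dt.action Dt.cuspLaws).Φ₀.obj Y)}
    {D : Type u₀} [Category.{v₀} D] {VD : FrdICatStub.{u₀, v₀, 0} D}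
    (C₀ : TemperedFrobenioid
      (RealifiedDivisorMonoids.ofRlfZWeak (DivisorMonoids.ofGaloisActionConnected Dt.action Dt.cuspLaws) hpf) D VD) :
    (∀ X : C₀.category, FrobenioidFacade.AutActionFactorsThrough (C₀.base ⋙ Dt.action.cnstFunctor) C₀.toElem X) ∧
      ∀ X : C₀.category, FrobenioidFacade.AutActionFaithful (C₀.base ⋙ Dt.action.cnstFunctor) C₀.toElem X :=
  C₀.thm37_iii_node_of_constField Dt.action Dt.cuspLaws Dt.constField

variable (R S : ((Discrete PUnit.{1})ᵒᵖ ⥤ CommMonCat.{0}) → Prop)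

/-- **The node for THE constructed tempered Frobenioid of the arithmetic Tate tower** (`TateTowerArithFrd.temperedFrobenioid
Dt`: the base-field Frobenioid at the bottom of the tower, base `pt ↦ G/G = X`, over data with a genuine constant field;
abc-iut-w6-d058): a closed term, no hypothesis of any kind. [cite: MochizukiEtTh2009, Thm 3.7 (iii) p.79] -/
theorem thm37_iii_node_tateTowerArithFrd :
    (∀ X : (TateTowerArithFrd.temperedFrobenioid Dt R S).category,
        FrobenioidFacade.AutActionFactorsThrough
          ((TateTowerArithFrd.temperedFrobenioid Dt R S).base ⋙ Dt.action.cnstFunctor)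
          (TateTowerArithFrd.temperedFrobenioid Dt R S).toElem X) ∧
      ∀ X : (TateTowerArithFrd.temperedFrobenioid Dt R S).category,
        FrobenioidFacade.AutActionFaithful
          ((TateTowerArithFrd.temperedFrobenioid Dt R S).base ⋙ Dt.action.cnstFunctor)
          (TateTowerArithFrd.temperedFrobenioid Dt R S).toElem X :=
  (TateTowerArithFrd.temperedFrobenioid Dt R S).thm37_iii_node_tateTowerArith Dt

/-- **AS TYPED there**: abc-iut-L2-t3's `Thm37_iii` for the constructed tempered Frobenioid of the arithmetic Tate tower
at the facade instantiated with print's `D₀ → D^cnst` (any facade `F` for the remaining [FrdI] fields) — a closed term.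
[cite: MochizukiEtTh2009, Thm 3.7 (iii) p.79] -/
theorem thm37_iii_tateTowerArithFrd (F : FrobenioidFacade.{0, 0, 0} (Discrete PUnit.{1})) :
    (TateTowerArithFrd.temperedFrobenioid Dt R S).Thm37_iii
      (F.withCnst ((TateTowerArithFrd.temperedFrobenioid Dt R S).base ⋙ Dt.action.cnstFunctor)) :=
  (TateTowerArithFrd.temperedFrobenioid Dt R S).thm37_iii_of_slot_of_constField Dt.action Dt.cuspLaws
    Dt.constField _ (fun _ h => h) fun _ h => h

/-- **NON-VACUITY with a NON-trivial constant-field Galois group**: at the `ℚ(i)`-tower over the inert prime `3`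
(`TateTowerArith.Datum.gaussian`, abc-iut-w5-d223: `Aut(ℚ(i)/ℚ) = {1, conj}`, `conj ∉ N` —
`gaussian_conj_not_mem_constInertia` — so `D₀ → D^cnst` is NOT a constant functor and sentence 2 reads on a genuine
`Aut_{D^cnst}`) the node holds for the constructed tempered Frobenioid, closed term.
[cite: MochizukiEtTh2009, Thm 3.7 (iii) p.79] -/
theorem thm37_iii_node_gaussianFrd :
    ((∀ X : (TateTowerArithFrd.temperedFrobenioid TateTowerArith.Datum.gaussian R S).category,
        FrobenioidFacade.AutActionFactorsThrough
          ((TateTowerArithFrd.temperedFrobenioid TateTowerArith.Datum.gaussian R S).base ⋙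
            TateTowerArith.Datum.gaussian.action.cnstFunctor)
          (TateTowerArithFrd.temperedFrobenioid TateTowerArith.Datum.gaussian R S).toElem X) ∧
      ∀ X : (TateTowerArithFrd.temperedFrobenioid TateTowerArith.Datum.gaussian R S).category,
        FrobenioidFacade.AutActionFaithful
          ((TateTowerArithFrd.temperedFrobenioid TateTowerArith.Datum.gaussian R S).base ⋙
            TateTowerArith.Datum.gaussian.action.cnstFunctor)
          (TateTowerArithFrd.temperedFrobenioid TateTowerArith.Datum.gaussian R S).toElem X) ∧
      ∃ σ : GaussianRat ≃ₐ[ℚ] GaussianRat, ((1 : Multiplicative ℤ), σ) ∉ TateTowerArith.Datum.gaussian.action.constInertia :=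
  ⟨thm37_iii_node_tateTowerArithFrd TateTowerArith.Datum.gaussian R S,
    ⟨GaussianRat.conj, TateTowerArith.gaussian_conj_not_mem_constInertia⟩⟩

end TateTowerArith

end TemperedFrobenioid

end Literature.AnabelianGeometry.EtaleTheta
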